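import Summits.Ventures.PercRepro.RankLevelSetIndepCDSum
import Summits.Ventures.PercRepro.RankLevelSetIndepCDTruncate
import Summits.Ventures.PercRepro.RankLevelSetBiIndepLRModel
import Summits.Ventures.PercRepro.RankLevelSetBiIndepPF2

/-! # RankLevelSetIndepCDModel — (CD) HOLDS ON EVERY UNIFORM MATROID AND ON THE WHOLE MODEL FAMILY, UNCONDITIONALLY
(night-1 g28; dossier §40)

For the uniform matroid `U_{p,E} = modelMatroid hE ∅ q p` the (CD) profiles at `e ∈ E` are the binomial rows with a
window: `x_k = C(#E − 1, k)` for `k + 1 ≤ p` (else `0`), `y_k = C(#E − 1, k)` for `k ≤ p` (else `0`)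
(`contractCount_uniform`, `deleteCount_uniform`), so `[x; y]` is TP2 with EQUALITY inside the window:
**`indepCD_uniform`**. The independence profile `I_k = C(#E, k)` (`k ≤ p`) satisfies the all-spreads log-concavity
`IndepPF2` (the named fact of `RankLevelSetIndepCDSum`, PROVED here for uniform matroids from the binomial log-concavity
`choose_sq_ge_choose_pred_mul_choose_succ` by the spread induction `choose_spread`): **`indepPF2_uniform`**. Hence, by
the direct-sum closure `indepCD_disjointSum` (which needs `IndepPF2` of the summands) and the truncation closure
`indepCD_truncateTo`, with `modelMatroid_eq_truncateTo_disjointSum` (the model `T_p(U_{q,F} ⊕ U_{D,D})` IS the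
truncation of the disjoint sum of two uniform matroids): **`indepCD_modelMatroid : IndepCD (modelMatroid hE F q p)`**
for every finite `E`, `F ⊆ E`, `q`, `p` — the (CD)-class contains the whole model family of the cell, with no named
fact. Every declaration has a docstring; imports: the cell's own modules and Mathlib only. Axioms: standard. -/

namespace PercRepro

open Set Matroid

variable {α : Type}

/-! ## Uniform matroids -/

/-- Independence in the uniform matroid `modelMatroid hE ∅ q p`: `X ⊆ E` and `#X ≤ p`. -/
lemma uniform_indep_iff {E : Set α} (hE : E.Finite) (q p : ℕ) (X : Set α) :
    (modelMatroid hE ∅ q p).Indep X ↔ X ⊆ E ∧ X.ncard ≤ p := by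
  rw [modelMatroid_indep_iff]
  simp only [Set.inter_empty, Set.ncard_empty, zero_le, true_and]

/-- **The contraction profile of a uniform matroid is a windowed binomial row**: `x_k = C(#E − 1, k)` for
`k + 1 ≤ p`, else `0`. -/
lemma contractCount_uniform {E : Set α} (hE : E.Finite) (q p : ℕ) {e : α} (he : e ∈ E) (k : ℕ) :
    contractCount (modelMatroid hE ∅ q p) e k = if k + 1 ≤ p then (E.ncard - 1).choose k else 0 := by
  unfold contractCount
  simp only [modelMatroid_E, uniform_indep_iff]
  have hE' : (E \ {e}).Finite := hE.subset Set.sdiff_subset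
  split_ifs with hkp
  · rw [← Set.ncard_sdiff_singleton_of_mem he, ← ncard_subsets_of_finite hE' k]
    congr 1
    ext T
    simp only [Set.mem_setOf_eq]
    constructor
    · rintro ⟨hTE, hT, -⟩; exact ⟨hTE, hT⟩
    · rintro ⟨hTE, hT⟩
      refine ⟨hTE, hT, ?_, ?_⟩
      · exact Set.insert_subset he (hTE.trans Set.sdiff_subset)
      · have heT : e ∉ T := fun hmem => (hTE hmem).2 rfl
        rw [Set.ncard_insert_of_notMem heT (hE'.subset hTE), hT]
        exact hkp
  · rw [Set.ncard_eq_zero (hE'.finite_subsets.subset (fun T hT => hT.1))]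
    ext T
    simp only [Set.mem_setOf_eq, Set.mem_empty_iff_false, iff_false, not_and]
    intro hTE hT _ hcard
    have heT : e ∉ T := fun hmem => (hTE hmem).2 rfl
    rw [Set.ncard_insert_of_notMem heT (hE'.subset hTE), hT] at hcard
    exact hkp hcard

/-- **The deletion profile of a uniform matroid is a windowed binomial row**: `y_k = C(#E − 1, k)` for `k ≤ p`,
else `0`. -/
lemma deleteCount_uniform {E : Set α} (hE : E.Finite) (q p : ℕ) {e : α} (he : e ∈ E) (k : ℕ) :
    deleteCount (modelMatroid hE ∅ q p) e k = if k ≤ p then (E.ncard - 1).choose k else 0 := by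
  unfold deleteCount
  simp only [modelMatroid_E, uniform_indep_iff]
  have hE' : (E \ {e}).Finite := hE.subset Set.sdiff_subset
  split_ifs with hkp
  · rw [← Set.ncard_sdiff_singleton_of_mem he, ← ncard_subsets_of_finite hE' k]
    congr 1
    ext T
    simp only [Set.mem_setOf_eq]
    constructor
    · rintro ⟨hTE, hT, -⟩; exact ⟨hTE, hT⟩
    · rintro ⟨hTE, hT⟩
      exact ⟨hTE, hT, hTE.trans Set.sdiff_subset, hT ▸ hkp⟩
  · rw [Set.ncard_eq_zero (hE'.finite_subsets.subset (fun T hT => hT.1))]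
    ext T
    simp only [Set.mem_setOf_eq, Set.mem_empty_iff_false, iff_false, not_and]
    intro _ hT _ hcard
    rw [hT] at hcard
    exact hkp hcard

/-- **(CD) holds on every uniform matroid** (equality inside the window, a zero factor outside). -/
theorem indepCD_uniform {E : Set α} (hE : E.Finite) (q p : ℕ) : IndepCD (modelMatroid hE ∅ q p) := by
  intro e he k
  rw [modelMatroid_E] at he
  rw [contractCount_uniform hE q p he, contractCount_uniform hE q p he, deleteCount_uniform hE q p he,
    deleteCount_uniform hE q p he]
  by_cases hkp : k + 2 ≤ p
  · rw [if_pos (by omega), if_pos (by omega), if_pos (by omega), if_pos (by omega), mul_comm]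
  · rw [if_neg (by omega), zero_mul]
    exact Nat.zero_le _

/-- **The independence profile of a uniform matroid**: `I_k = C(#E, k)` for `k ≤ p`, else `0`. -/
lemma indepLevelCount_uniform {E : Set α} (hE : E.Finite) (q p k : ℕ) :
    indepLevelCount (modelMatroid hE ∅ q p) k = if k ≤ p then E.ncard.choose k else 0 := by
  unfold indepLevelCount indepLevel
  simp only [modelMatroid_E, uniform_indep_iff]
  split_ifs with hkp
  · rw [← ncard_subsets_of_finite hE k]
    congr 1
    ext T
    simp only [Set.mem_setOf_eq]
    constructor
    · rintro ⟨hTE, hT, -⟩; exact ⟨hTE, hT⟩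
    · rintro ⟨hTE, hT⟩; exact ⟨hTE, hT, hTE, hT ▸ hkp⟩
  · rw [Set.ncard_eq_zero (hE.finite_subsets.subset (fun T hT => hT.1))]
    ext T
    simp only [Set.mem_setOf_eq, Set.mem_empty_iff_false, iff_false, not_and]
    intro _ hT _ hcard
    rw [hT] at hcard
    exact hkp hcard

/-! ## The spread form of the binomial log-concavity -/

/-- **Binomial log-concavity spreads one step**: `C(n, u−1) · C(n, v+1) ≤ C(n, u) · C(n, v)` for `1 ≤ u ≤ v`,
`v + 1 ≤ n`. -/
lemma choose_spread_step {n u v : ℕ} (hu : 1 ≤ u) (huv : u ≤ v) (hvn : v + 1 ≤ n) :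
    n.choose (u - 1) * n.choose (v + 1) ≤ n.choose u * n.choose v := by
  induction v, huv using Nat.le_induction with
  | base =>
    have := choose_sq_ge_choose_pred_mul_choose_succ hu hvn
    rwa [pow_two] at this
  | succ v huv ih =>
    have ih' := ih (by omega)
    have hlc := choose_sq_ge_choose_pred_mul_choose_succ (n := n) (r := v + 1) (by omega) hvn
    rw [show v + 1 - 1 = v by omega, pow_two] at hlc
    have hpos : 0 < n.choose v * n.choose (v + 1) :=
      Nat.mul_pos (Nat.choose_pos (by omega)) (Nat.choose_pos (by omega))
    have key : n.choose (u - 1) * n.choose (v + 1 + 1) * (n.choose v * n.choose (v + 1)) ≤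
        n.choose u * n.choose (v + 1) * (n.choose v * n.choose (v + 1)) := by
      calc n.choose (u - 1) * n.choose (v + 1 + 1) * (n.choose v * n.choose (v + 1))
          = (n.choose (u - 1) * n.choose (v + 1)) * (n.choose v * n.choose (v + 1 + 1)) := by ring
        _ ≤ (n.choose u * n.choose v) * (n.choose (v + 1) * n.choose (v + 1)) :=
            Nat.mul_le_mul ih' hlc
        _ = n.choose u * n.choose (v + 1) * (n.choose v * n.choose (v + 1)) := by ring
    exact Nat.le_of_mul_le_mul_right key hpos

/-- **The all-spreads binomial inequality**: `C(n, x−k) · C(n, y+k) ≤ C(n, x) · C(n, y)` for `x ≤ y`, `k ≤ x`. -/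
lemma choose_spread {n x y k : ℕ} (hxy : x ≤ y) (hkx : k ≤ x) :
    n.choose (x - k) * n.choose (y + k) ≤ n.choose x * n.choose y := by
  induction k with
  | zero => simp
  | succ k ih =>
    have ih' := ih (by omega)
    by_cases hyn : y + k + 1 ≤ n
    · have hstep := choose_spread_step (n := n) (u := x - k) (v := y + k) (by omega) (by omega) hyn
      rw [show x - k - 1 = x - (k + 1) by omega, show y + k + 1 = y + (k + 1) by omega] at hstep
      exact hstep.trans ih'
    · rw [Nat.choose_eq_zero_of_lt (by omega : n < y + (k + 1)), mul_zero]
      exact Nat.zero_le _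

/-- **The named fact `IndepPF2` holds for every uniform matroid** (all-spreads log-concavity of the binomial row). -/
theorem indepPF2_uniform {E : Set α} (hE : E.Finite) (q p : ℕ) : IndepPF2 (modelMatroid hE ∅ q p) := by
  intro x y k hxy hkx
  rw [indepLevelCount_uniform, indepLevelCount_uniform, indepLevelCount_uniform, indepLevelCount_uniform]
  by_cases hyk : y + k ≤ p
  · rw [if_pos (by omega), if_pos hyk, if_pos (by omega), if_pos (by omega)]
    exact choose_spread hxy hkx
  · rw [if_neg hyk, mul_zero]
    exact Nat.zero_le _

/-! ## The model family -/

/-- **(CD) HOLDS ON THE WHOLE MODEL FAMILY** `T_p(U_{q,F} ⊕ U_{E∖F,E∖F})`, unconditionally: the model is the truncation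
of a disjoint sum of two uniform matroids, (CD) and `IndepPF2` hold on uniform matroids, and the (CD)-class is closed
under disjoint sums (given `IndepPF2` of the summands) and truncations. -/
theorem indepCD_modelMatroid {E : Set α} (hE : E.Finite) {F : Set α} (hF : F ⊆ E) (q p : ℕ) :
    IndepCD (modelMatroid hE F q p) := by
  haveI := modelMatroid_finite (hE.subset hF) ∅ q q
  haveI := modelMatroid_finite ((hE.subset (Set.sdiff_subset : E \ F ⊆ E))) ∅ (E \ F).ncard (E \ F).ncard
  have hdisj : Disjoint (modelMatroid (hE.subset hF) ∅ q q).E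
      (modelMatroid ((hE.subset (Set.sdiff_subset : E \ F ⊆ E))) ∅ (E \ F).ncard (E \ F).ncard).E :=
    Set.disjoint_sdiff_right
  haveI hfin : ((modelMatroid (hE.subset hF) ∅ q q).disjointSum
      (modelMatroid ((hE.subset (Set.sdiff_subset : E \ F ⊆ E))) ∅ (E \ F).ncard (E \ F).ncard) hdisj).Finite :=
    ⟨by rw [Matroid.disjointSum_ground_eq, modelMatroid_E, modelMatroid_E]
        exact (hE.subset hF).union ((hE.subset (Set.sdiff_subset : E \ F ⊆ E)))⟩
  rw [modelMatroid_eq_truncateTo_disjointSum hE hF q p]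
  apply indepCD_truncateTo
  exact indepCD_disjointSum _ _ hdisj (indepCD_uniform (hE.subset hF) q q)
    (indepCD_uniform ((hE.subset (Set.sdiff_subset : E \ F ⊆ E))) _ _) (indepPF2_uniform (hE.subset hF) q q)
    (indepPF2_uniform ((hE.subset (Set.sdiff_subset : E \ F ⊆ E))) _ _)

end PercRepro
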